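import Literature.NumberTheory.EllipticCurves.BSDSelmerCMPConverseMaximalOrderProofs
import HarnessLib

/-!
# Burungale–Kobayashi–Ota 2024, Thm. 1.5: the `p`-converse to Gross–Zagier–Kolyvagin for CM elliptic curves over `ℚ` at a prime `p ≥ 5` of good SUPERSINGULAR (= inert) reduction

HONEST FRAMING (cell `b2b-bsdres`, run/shared/lean/b2b/bsd-rank1-residual/; harvest seat
`b2b-bsdres-harvest-1`, gen 10, "BKO pull"): prove what is provable now; shrink each hard class
to its core with data; no claim beyond stated classes. The cell deletes the COMBINATION-SHAPED
residual classes of the BSD formula in analytic rank `≤ 1` from PUBLISHED theorems only and TYPES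
the construction-shaped ones; this is not "finishing BSD". This file vendors ONE published theorem
(a named fact, nothing asserted; D-0014) from the Burungale–Kobayashi–Ota series on CM Iwasawa
theory at INERT primes, and says exactly which cell of the partition grid it bears on.

## Citation header

A. A. Burungale, S. Kobayashi, K. Ota, *`p`-adic `L`-functions and rational points on CM elliptic
curves at inert primes*, J. Inst. Math. Jussieu **23** (2024), no. 3, 1417–1460,
doi:10.1017/S147474802300021X [BurungaleKobayashiOta2023] (received 6 July 2021, published online
2023; open access CC-BY). READ for this file from the publisher's typeset PDF (44 pp., Cambridge
Core `…/S147474802300021Xa.pdf`, sha256 `b47ec4c4…8792`, text key `paper:url-99d72e124e36`) and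
the publisher's full-text HTML (MathJax sources of the displayed formulas); the held JATS text
`paper:doi-10-1017-s147474802300021x` drops every displayed formula and must not be quoted for them.

**Theorem 1.5, verbatim** (§1.2.3 "p-converse to a theorem of Gross–Zagier and Kolyvagin",
p. 1422): "Let `E_{/ℚ}` be a CM elliptic curve with good supersingular reduction at `p ≥ 5`. If
`corank_{ℤ_p} Sel_{p^∞}(E) = 1` and `Ш(E)[p^∞]` is finite, then `ord_{s=1} L(E_{/ℚ}, s) = 1`."
Followed by: "See also Theorem 4.18 in a more general setting. Just as the Bertolini–Darmon–Prasanna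
formula is employed in the proof of Skinner's `p`-converse [52], our approach is based on
Theorem 1.1." Remark 1.6: "(i) The first results towards the `p`-converse were due to Rubin [51],
which treated CM elliptic curves and ordinary primes `p`. […] (ii) One may seek a refined
`p`-converse: `corank_{ℤ_p} Sel_{p^∞}(E) = 1 ⟹ ord_{s=1} L(E_{/ℚ}, s) = 1` (1.6) (cf. [56], [18],
[16], [10], [11]). While it may be possible to approach Theorem 1.5 via the `p`-adic Gross–Zagier
formula [32], with a view to (1.6), our approach instead employs Theorem 1.1."
Standing setting of §1.2 (p. 1419): "Let `p ≥ 5` be a prime. […] Let `K` be an imaginary quadratic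
field with `p` inert and `𝒪_K` the integer ring. […] In this introduction, we assume the class
number `h_K` of `K` equals 1; however, the main text only assumes `p ∤ h_K`. […] Let `E` be an
elliptic curve defined over `ℚ` with complex multiplication by `𝒪_K` with good reduction at `p`
(note that `E` has supersingular reduction at `p` since `p` is inert)."
**Theorem 4.18, verbatim** (p. 1448–1449, the "more general setting"): "Let `A_{/ℚ}` be a
`GL₂`-type CM abelian variety. Let `K` be the CM field and `F` the Hecke field. Suppose that (rt)
holds and `𝒪_F ↪ End A`. Let `p ≥ 5` be a prime of good non-ordinary reduction for `A_{/ℚ}` with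
`p ∤ h_K`, and `𝔭` a prime of `F` above `p`. Suppose either of the following. (a)
`corank_{𝒪_{F,𝔭}} Sel_{𝔭^∞}(A) = 1` and `loc_p : Sel_{𝔭^∞}(A) → A(ℚ_p) ⊗_{𝒪_F} F_𝔭/𝒪_{F_𝔭}` is a
non-zero map. (b) `corank_{𝒪_{F,𝔭}} Sel_{𝔭^∞}(A) = 1` and `Ш(A)[𝔭^∞]` is finite. Then,
`ord_{s=1} L(A, s) = [F : ℚ]`." Remark 4.19: "The `p`-converse was initiated by Skinner and Zhang
(cf. [52], [56]). The above approach is a variant of [52], yet it does not rely on the parity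
conjecture."

HYPOTHESES ENUMERATED (Thm. 1.5 as printed, for an elliptic curve): `E/ℚ`; complex multiplication
by the MAXIMAL order `𝒪_K` of its CM field `K` (§1.2; `h_K = 1` is automatic for a CM curve over
`ℚ`); `p ≥ 5`; GOOD reduction at `p`; SUPERSINGULAR at `p` (equivalently `p` inert in `K`;
`p ∤ h_K` vacuous); `corank_{ℤ_p} Sel_{p^∞}(E/ℚ) = 1`; `Ш(E/ℚ)[p^∞]` finite. No image, torsion,
Tamagawa, root-number or conductor hypothesis. Refereed: PUBLISHED (JIMJ 23 (2024)).

## Transcription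

`W` a globally minimal Weierstrass equation over `ℚ` (only to read the true `a_p` as
`W.frobeniusTrace p`); "CM by `𝒪_K`" = `W.j ∈ maximalCMJInvariants` (the nine maximal-order
`j`-invariants, `ComplexMultiplication.lean`; Silverman, *Advanced Topics*, App. A §3); `5 ≤ p`;
good reduction `W.HasGoodReductionAtPrime p`; supersingular = `(p : ℤ) ∣ W.frobeniusTrace p` (for
`p ≥ 5` of good reduction `a_p ≡ 0 (mod p) ⟺ a_p = 0` by Hasse; this is the cell's `GoodSS`);
`W.selmerCorank p = 1` (the `ℤ_p`-corank of `Sel_{p^∞}(E/ℚ)`, `Selmer.lean`);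
`Finite (AddCommGroup.primaryComponent W.sha p)` (`Ш(E/ℚ)[p^∞]` finite); conclusion
`W.analyticRank = 1` (`ord_{s=1} L(E/ℚ, s)`). This is Theorem 1.5 at its printed strength — the
supersingular companion of the tree's Burungale–Tian fact
`burungaleTian_analyticRank_eq_one_of_selmerCorank_eq_one_of_hasCM` (good ORDINARY `p ≥ 5`,
WITHOUT the `Ш[p^∞]` hypothesis; `BSDSelmerCMPConverse.lean`). The extension from CM by `𝒪_K` to
CM by an arbitrary order (the four `j ∈ {54000, 287496, −12288000, 16581375}`) is NOT vendored as
part of the fact: it is PROVED below (`thm15_of_hasCM`) by the `ℚ`-isogeny to a maximal-order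
curve, every hypothesis and the conclusion being `ℚ`-isogeny invariants (tree theorems).

NOT PROVABLE from Mathlib or this library at present (no `_holds`): the printed proof (§4.1.4,
Thm. 4.17 ⟹ Thm. 4.18) runs through Theorem 1.1 = Thm. 4.8 (Rubin's formula at inert `p`:
`ℒ_E(1)` is, up to `ℚ^× 𝒪_K^×`, `(1 + 1/p) log_ω(P)² / λ_E(v₋,0)` for a rational point `P`, with
`P` non-torsion iff `ord_{s=1} L(E,s) = 1`), itself resting on Rubin's conjecture on anticyclotomic
local units (Burungale–Kobayashi–Ota, Ann. of Math. 194 (2021) [BurungaleKobayashiOta2021],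
Thm. 2.1 here), the Rubin `p`-adic `L`-function `ℒ_E` [47, §10], elliptic units (Coates–Wiles),
the anticyclotomic main conjecture of Agboola–Howard [2, Thm. 5.2 / Prop. 3.3], a variant of
Kobayashi's `p`-adic Gross–Zagier formula (App. A, Thm. A.6) and the Perrin-Riou conjecture for
`GL₂`-type abelian varieties at non-ordinary primes (App. B, Thm. B.3). None of these objects
(anticyclotomic tower of the unramified quadratic extension of `ℚ_p`, norm-coherent local units
`U_∞`, `V^{*,±}_∞`, Coates–Wiles logarithmic derivative `δ`, `ℒ_E`, elliptic-unit Selmer elements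
`z_χ`) exists in the tree or in Mathlib. Consumers take `(h : thm15_analyticRank_eq_one_of_selmerCorank_eq_one)`.

## What else the BKO series prints, and why it is NOT typed here (statements need absent objects)

* Thm. 1.1 / Thm. 4.8 (Rubin's formula, root number `−1`, `p ≥ 5` good supersingular), Thm. 1.2 /
  Thm. 3.16 (interpolation of `ℒ_E` at `χ ∈ Ξ^{−ε}`: `ℒ_E(χ⁻¹) = δ_χ(v_{−ε}) · log_ω(z_χ)`), Cor. 1.4 /
  Cor. 4.11 (corank jumps `ε_n p^{n−1}(p−1)` along the anticyclotomic layers `K_n`), Cor. 4.9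
  (`p`-adic CONSTRUCTION of a rational point of infinite order ASSUMING `ord_{s=1} L(E,s) = 1` AND
  the BSD formula for `E/ℚ` — it USES the `p`-part, it does not prove it; Rem. 4.10 (i), typeset
  PDF p. 1444: "The BSD formula is known to be true up to an element in `ℤ[1/(#𝒪_K^× · N)]^×`
  (cf. [32, Cor. 1.4])", i.e. Kobayashi 2013 Cor. 1.4 — the tree's fact
  `Kobayashi2013.cor14_bsdp_of_cm_rank_one`; the cell's earlier rendering "`ℤ_{(p)}^×`" of this
  sentence came from the formula-stripped JATS text and is superseded by the typeset reading).
* Burungale–Kobayashi–Ota, Ann. of Math. 194 (2021) 943–966: Rubin's conjecture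
  `V^*_∞ = V^{*,+}_∞ ⊕ V^{*,−}_∞` (`p ≥ 5`; zbMATH Zbl 1487.11100) and, as a consequence, the
  Agboola–Howard anticyclotomic main conjecture for CM curves at inert `p ≥ 5` of GOOD reduction
  made unconditional; Yan–Zhu, Ramanujan J. 66 (2025) [YanZhu2025]: the case `p = 3`.
* Later items of the series (Kato's `ε`-conjecture for anticyclotomic CM deformations, J. Number
  Theory 270 (2025); the `Ш(E/K_n)` growth paper, Bertolinifest proceedings (2026); the `p`-adic
  valuation of anticyclotomic Hecke `L`-values, arXiv:2507.08221, "to appear in Amer. J. Math.":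
  `p ∤ 6N` inert; Burungale–Kobayashi–Nakamura–Ota, arXiv:2508.17776 [BurungaleKobayashiNakamuraOta2025]
  (local sign decomposition; a bounded anticyclotomic `p`-adic `L`-function at primes RAMIFIED in
  `K`, Thm. 3.15; Rem. 2.31 ANNOUNCES "an integral `p`-adic `L`-function and a main conjecture" in
  the inert NON-SEMISTABLE case) and arXiv:2608.06879 (ramified primes)) are either about good
  inert `p ∤ 6N` or PRE-PUBLICATION, and none states a `p`-part-of-BSD formula.

## Which cell of the partition grid this bears on (HOME/PARTITION.md §3)

Row 4 — `p` odd, cm, `r = 1`, `p` NOT split in `K`, GOOD reduction (for `p ≥ 5` this is exactly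
"good supersingular at `p ≥ 5`") — whose BSD_p target is C10 = Kobayashi 2013 Cor. 1.4
(`Kobayashi2013.bsdp_of_cor14`). Theorem 1.5 is an INPUT-SIDE statement there (it certifies
`ord_{s=1} L(E,s) = 1` from `rank E(ℚ) = 1 ∧ #Ш(E/ℚ)[p^∞] < ∞`, see
`analyticRank_eq_one_of_mordellWeilRank_eq_one_of_finite_sha_primary`), not a `p`-part statement.
Row 5 — cm, `r = 1`, `p` not split, BAD (the X12 core: `p` ramified in `K`, or inert in `K` of
additive reduction) — is NOT touched: every theorem of the series carries "good (supersingular)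
reduction at `p`" resp. "`p ∤ 6N`". Nothing in X12's typed residue (`Typed/X12.lean`,
`X12.MissingInputAt`) moves.

## References

* [BurungaleKobayashiOta2023] A. A. Burungale, S. Kobayashi, K. Ota, J. Inst. Math. Jussieu 23
  (2024), 1417–1460: Thm. 1.5 (p. 1422), Thm. 4.18 (pp. 1448–1449), Rem. 1.6, Rem. 4.10, Rem. 4.19.
* [BurungaleKobayashiOta2021] A. Burungale, S. Kobayashi, K. Ota, Ann. of Math. (2) 194 (2021),
  943–966 (Rubin's conjecture; `p ≥ 5`).
* [YanZhu2025] X. Yan, X. Zhu, Ramanujan J. 66 (2025), Paper 49 (Rubin's conjecture, `p = 3`).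
* [BurungaleKobayashiNakamuraOta2025] arXiv:2508.17776 (PRE; ramified / non-semistable primes).
* [BurungaleTian2019] A. A. Burungale, Y. Tian, Invent. Math. 220 (2020), Thm. 1.2 (ordinary case).
* [Kim2022] C.-H. Kim, Math. Ann. 387 (2022), §1 diagram (1.1) (the shape "rank 1 ∧ `#Ш[p^∞] < ∞`
  ⟹ `ord = 1`").
* [Greenberg1999LNM] R. Greenberg, LNM 1716, §1 (`corank Sel = rank + corank Ш`; isogeny invariance).
* [SilvermanAdvancedTopics1994] App. A §3 and II Ex. 2.12(b) (maximal orders; isogeny to `𝒪_K`).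
* [Darmon2004] H. Darmon, CBMS 101, Thm. 3.22 (Gross–Zagier–Kolyvagin).
-/

noncomputable section

open scoped Classical

open WeierstrassCurve Literature.NumberTheory.EllipticCurves

namespace Literature.NumberTheory.EllipticCurves.BurungaleKobayashiOta2024

/-- **Burungale–Kobayashi–Ota 2024, Theorem 1.5 (the `p`-converse to Gross–Zagier–Kolyvagin for
CM elliptic curves at a good supersingular prime `p ≥ 5`)**, J. Inst. Math. Jussieu 23 (2024),
p. 1422, verbatim: "Let `E_{/ℚ}` be a CM elliptic curve with good supersingular reduction at
`p ≥ 5`. If `corank_{ℤ_p} Sel_{p^∞}(E) = 1` and `Ш(E)[p^∞]` is finite, then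
`ord_{s=1} L(E_{/ℚ}, s) = 1`." In the paper's standing setting (§1.2, p. 1419) "CM elliptic
curve" is "an elliptic curve defined over `ℚ` with complex multiplication by `𝒪_K`" (`K` the CM
field, `p` inert in `K`, `h_K = 1`); the general form is Thm. 4.18 (b) (`GL₂`-type CM abelian
varieties, `p ≥ 5` good non-ordinary, `p ∤ h_K`). Transcription: `W/ℚ` globally minimal (to read
`a_p`); `W.j ∈ maximalCMJInvariants` (CM by the maximal order `𝒪_K`); `5 ≤ p`; good reduction at
`p`; `p ∣ a_p` (supersingular); `corank_{ℤ_p} Sel_{p^∞}(E/ℚ) = 1`; `Ш(E/ℚ)[p^∞]` finite;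
conclusion `ord_{s=1} L(E/ℚ, s) = 1`. The form for CM by an arbitrary order is the THEOREM
`thm15_of_hasCM` below. Nothing weaker or stronger is vendored; no `_holds` (the printed proof
needs the structure theorem for anticyclotomic local units of Burungale–Kobayashi–Ota 2021, the
Rubin `p`-adic `L`-function and Rubin's formula Thm. 1.1, absent from the tree — see the module
docstring). PUBLISHED and refereed (JIMJ 2024); a theorem in print, vendored as a named fact.
[cite: BurungaleKobayashiOta2023, Thm. 1.5 (p. 1422); Thm. 4.18 (b) (pp. 1448–1449); §1.2 (p. 1419)] -/
def thm15_analyticRank_eq_one_of_selmerCorank_eq_one : Prop :=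
  ∀ (W : WeierstrassCurve ℚ) [W.IsElliptic] [W.IsGloballyMinimal]
    (_hj : W.j ∈ maximalCMJInvariants) (p : ℕ) [Fact p.Prime] (_hp : 5 ≤ p)
    (_hgood : W.HasGoodReductionAtPrime p) (_hss : (p : ℤ) ∣ W.frobeniusTrace p)
    (_hSel : W.selmerCorank p = 1) (_hsha : Finite (AddCommGroup.primaryComponent W.sha p)),
    W.analyticRank = 1

/-! ### From CM by `𝒪_K` to CM by any order (proved: a `ℚ`-isogeny to a maximal-order curve) -/

/-- **Finiteness of `Ш[p^∞]` is a `ℚ`-isogeny invariant** (through the corank: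
`corank_{ℤ_p} Ш(E)[p^∞] = corank_{ℤ_p} Ш(E')[p^∞]`, Greenberg LNM 1716 §1 / Milne *ADT* I.7.1(b),
tree theorem `IsIsogenous.shaCorank_eq`, and "finite ⟺ corank `0`" for the `p`-primary group
`Ш[p^∞]` with finite `Ш[p]`, tree theorem `finite_primaryComponent_sha_iff_shaCorank_eq_zero`).
[cite: Greenberg1999LNM, §1 pp. 54–57] -/
theorem finite_primaryComponent_sha_iff_of_isIsogenous {W W' : WeierstrassCurve ℚ} [W.IsElliptic]
    [W'.IsElliptic] (h : IsIsogenous W W') (p : ℕ) [Fact p.Prime] :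
    Finite (AddCommGroup.primaryComponent W.sha p) ↔
      Finite (AddCommGroup.primaryComponent W'.sha p) := by
  rw [finite_primaryComponent_sha_iff_shaCorank_eq_zero W p,
    finite_primaryComponent_sha_iff_shaCorank_eq_zero W' p, h.shaCorank_eq p]

/-- **Theorem 1.5 for every CM elliptic curve over `ℚ`** (CM by an arbitrary order of the CM
field, the tree's `W.HasCM`), from the fact (CM by `𝒪_K`, as printed in §1.2). Proof: a CM curve
`E/ℚ` is `ℚ`-isogenous to a globally minimal `E'` with `j(E') ∈ maximalCMJInvariants` (Silverman,
*Advanced Topics*, II Ex. 2.12(b) + App. A §3; tree theorem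
`exists_isIsogenous_j_mem_maximalCMJInvariants_of_hasCM_holds`, packaged with *AEC* VIII.8.3 as
`exists_isGloballyMinimal_isIsogenous_of_hasCM`); along the isogeny good reduction at `p`
(*AEC* VII.7.2, `IsIsogenous.hasGoodReductionAtPrime_iff`), `a_p` (Faltings,
`frobeniusTrace_eq_of_isIsogenous`), the `p^∞`-Selmer corank (`IsIsogenous.selmerCorank_eq`),
finiteness of `Ш[p^∞]` (`finite_primaryComponent_sha_iff_of_isIsogenous`) and `ord_{s=1} L`
(`analyticRank_eq_of_isIsogenous'`, Knapp Thm. 11.67) are unchanged.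
[cite: BurungaleKobayashiOta2023, Thm. 1.5 (p. 1422) and §1.2 (p. 1419)]
[cite: SilvermanAdvancedTopics1994, Ch. II Exercise 2.12(b) (p. 175) and App. A §3 (p. 483)]
[cite: Greenberg1999LNM, §1 pp. 54–57] -/
theorem thm15_of_hasCM (h : thm15_analyticRank_eq_one_of_selmerCorank_eq_one)
    (W : WeierstrassCurve ℚ) [W.IsElliptic] [W.IsGloballyMinimal] (hCM : W.HasCM)
    (p : ℕ) [Fact p.Prime] (hp : 5 ≤ p) (hgood : W.HasGoodReductionAtPrime p)
    (hss : (p : ℤ) ∣ W.frobeniusTrace p) (hSel : W.selmerCorank p = 1)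
    (hsha : Finite (AddCommGroup.primaryComponent W.sha p)) : W.analyticRank = 1 := by
  obtain ⟨W', _, _, hiso, hj⟩ := exists_isGloballyMinimal_isIsogenous_of_hasCM
    exists_isIsogenous_j_mem_maximalCMJInvariants_of_hasCM_holds W hCM
  have hgood' : W'.HasGoodReductionAtPrime p := (hiso.hasGoodReductionAtPrime_iff p).mp hgood
  have hss' : (p : ℤ) ∣ W'.frobeniusTrace p := by
    rwa [← frobeniusTrace_eq_of_isIsogenous hiso p hgood hgood']
  have hSel' : W'.selmerCorank p = 1 := by rw [← hiso.selmerCorank_eq p, hSel]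
  have hsha' : Finite (AddCommGroup.primaryComponent W'.sha p) :=
    (finite_primaryComponent_sha_iff_of_isIsogenous hiso p).mp hsha
  rw [analyticRank_eq_of_isIsogenous' hiso]
  exact h W' hj p hp hgood' hss' hSel' hsha'

/-- **Bookkeeping, converse direction**: the `HasCM` form contains the printed (maximal-order)
form, a curve with `j ∈ maximalCMJInvariants` having CM (`hasCM_of_j_mem_maximalCMJInvariants_holds`,
Silverman *AEC* C.11.3.1). So the fact is EQUIVALENT to its `HasCM` form
(`thm15_iff_hasCM_form`). [cite: BurungaleKobayashiOta2023, Thm. 1.5 (p. 1422)]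
[cite: SilvermanAdvancedTopics1994, App. A §3 (p. 483)] -/
theorem thm15_iff_hasCM_form :
    thm15_analyticRank_eq_one_of_selmerCorank_eq_one ↔
      ∀ (W : WeierstrassCurve ℚ) [W.IsElliptic] [W.IsGloballyMinimal], W.HasCM →
        ∀ (p : ℕ) [Fact p.Prime], 5 ≤ p → W.HasGoodReductionAtPrime p →
          (p : ℤ) ∣ W.frobeniusTrace p → W.selmerCorank p = 1 →
            Finite (AddCommGroup.primaryComponent W.sha p) → W.analyticRank = 1 :=
  ⟨fun h W _ _ hCM p _ hp hgood hss hSel hsha ↦ thm15_of_hasCM h W hCM p hp hgood hss hSel hsha,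
    fun h W _ _ hj p _ hp hgood hss hSel hsha ↦
      h W (hasCM_of_j_mem_maximalCMJInvariants_holds W hj) p hp hgood hss hSel hsha⟩

/-! ### The hypothesis of Thm. 1.5 is "`rank E(ℚ) = 1` and `#Ш(E/ℚ)[p^∞] < ∞`" -/

/-- **`corank_{ℤ_p} Sel_{p^∞}(E/ℚ) = 1 ∧ #Ш[p^∞] < ∞ ⟺ rank E(ℚ) = 1 ∧ #Ш[p^∞] < ∞`** (any
elliptic curve over a number field): `corank Sel_{p^∞} = rank + corank Ш[p^∞]` (Greenberg 1999 §1,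
tree theorem `selmerCorank_eq_mordellWeilRank_add_holds`) and a finite `p`-primary group has
corank `0`. So Theorem 1.5 is literally the converse of Gross–Zagier–Kolyvagin "granted
`#Ш(E/ℚ)[p^∞] < ∞`" at a supersingular prime — the shape of Kim's diagram (1.1) and of Rubin's
ordinary CM result quoted in Rem. 1.6 (i). [cite: Greenberg1999LNM, §1 pp. 54–57]
[cite: Kim2022, §1 (before Cor. 1.4)] -/
theorem selmerCorank_eq_one_and_finite_iff_rank_eq_one_and_finite {K : Type} [Field K]
    [NumberField K] (W : WeierstrassCurve K) [W.IsElliptic] (p : ℕ) [Fact p.Prime] :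
    (W.selmerCorank p = 1 ∧ Finite (AddCommGroup.primaryComponent W.sha p)) ↔
      (W.mordellWeilRank = 1 ∧ Finite (AddCommGroup.primaryComponent W.sha p)) := by
  refine ⟨fun ⟨hSel, hsha⟩ ↦ ⟨?_, hsha⟩, fun ⟨hrank, hsha⟩ ↦
    ⟨selmerCorank_eq_one_of_mordellWeilRank_eq_one_of_finite W p hrank hsha, hsha⟩⟩
  have h := W.selmerCorank_eq_mordellWeilRank_add_holds p
  have h0 : W.shaCorank p = 0 := (finite_primaryComponent_sha_iff_shaCorank_eq_zero W p).1 hsha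
  omega

/-- **Converse of Gross–Zagier–Kolyvagin at a good supersingular prime, for CM curves** (the
fact in Kim's shape): for `E/ℚ` with complex multiplication and a prime `p ≥ 5` of good
supersingular reduction, `rank_ℤ E(ℚ) = 1 ∧ #Ш(E/ℚ)[p^∞] < ∞ ⟹ ord_{s=1} L(E, s) = 1`.
From the fact (`h`) through `thm15_of_hasCM` and
`selmerCorank_eq_one_of_mordellWeilRank_eq_one_of_finite`.
[cite: BurungaleKobayashiOta2023, Thm. 1.5 (p. 1422)] [cite: Kim2022, §1, diagram (1.1)] -/
theorem analyticRank_eq_one_of_mordellWeilRank_eq_one_of_finite_sha_primary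
    (h : thm15_analyticRank_eq_one_of_selmerCorank_eq_one)
    (W : WeierstrassCurve ℚ) [W.IsElliptic] [W.IsGloballyMinimal] (hCM : W.HasCM)
    (p : ℕ) [Fact p.Prime] (hp : 5 ≤ p) (hgood : W.HasGoodReductionAtPrime p)
    (hss : (p : ℤ) ∣ W.frobeniusTrace p) (hrank : W.mordellWeilRank = 1)
    (hsha : Finite (AddCommGroup.primaryComponent W.sha p)) : W.analyticRank = 1 :=
  thm15_of_hasCM h W hCM p hp hgood hss
    (selmerCorank_eq_one_of_mordellWeilRank_eq_one_of_finite W p hrank hsha) hsha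

/-- **Every GOOD prime `p ≥ 5` of a CM curve, ordinary or supersingular**: granted Burungale–Tian's
Thm. 1.2 (`hBT`, good ordinary `p ≥ 5`, tree fact
`burungaleTian_analyticRank_eq_one_of_selmerCorank_eq_one_of_hasCM`) and Burungale–Kobayashi–Ota's
Thm. 1.5 (`hBKO`, good supersingular `p ≥ 5`), for `E/ℚ` with complex multiplication and ANY
prime `p ≥ 5` of good reduction, `rank_ℤ E(ℚ) = 1 ∧ #Ш(E/ℚ)[p^∞] < ∞ ⟹ ord_{s=1} L(E, s) = 1`
(case split on `p ∣ a_p`). This is the first arrow of Kim's diagram (1.1) for CM curves with the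
ordinarity proviso removed. [cite: BurungaleKobayashiOta2023, Thm. 1.5 (p. 1422) and Rem. 1.6 (i)]
[cite: BurungaleTian2019, Thm. 1.2 (p. 214)] [cite: Kim2022, §1, diagram (1.1)] -/
theorem analyticRank_eq_one_of_mordellWeilRank_eq_one_of_finite_sha_primary_of_good
    (hBT : burungaleTian_analyticRank_eq_one_of_selmerCorank_eq_one_of_hasCM)
    (hBKO : thm15_analyticRank_eq_one_of_selmerCorank_eq_one)
    (W : WeierstrassCurve ℚ) [W.IsElliptic] [W.IsGloballyMinimal] (hCM : W.HasCM)
    (p : ℕ) [Fact p.Prime] (hp : 5 ≤ p) (hgood : W.HasGoodReductionAtPrime p)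
    (hrank : W.mordellWeilRank = 1) (hsha : Finite (AddCommGroup.primaryComponent W.sha p)) :
    W.analyticRank = 1 := by
  by_cases hss : (p : ℤ) ∣ W.frobeniusTrace p
  · exact analyticRank_eq_one_of_mordellWeilRank_eq_one_of_finite_sha_primary hBKO W hCM p hp
      hgood hss hrank hsha
  · exact hBT W hCM p hp hgood hss
      (selmerCorank_eq_one_of_mordellWeilRank_eq_one_of_finite W p hrank hsha)

/-- **Kim's diagram (1.1) at a good supersingular prime `p ≥ 5` of a CM curve, the whole cycle.**
For `E/ℚ` with complex multiplication (globally minimal model `W`) and `p ≥ 5` good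
supersingular, the following are equivalent: (a) `rank_ℤ E(ℚ) = 1` and `#Ш(E/ℚ)[p^∞] < ∞`;
(b) `ord_{s=1} L(E, s) = 1`; (c) `rank_ℤ E(ℚ) = 1` and `#Ш(E/ℚ) < ∞`. (a) ⟹ (b) is the fact
(`hBKO`); (b) ⟹ (c) is Gross–Zagier–Kolyvagin (`hGZK`, tree fact
`rank_eq_analyticRank_of_analyticRank_le_one`); (c) ⟹ (a) is trivial.
[cite: BurungaleKobayashiOta2023, Thm. 1.5 (p. 1422)] [cite: Kim2022, §1, diagram (1.1)]
[cite: Darmon2004, Thm. 3.22] -/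
theorem kim_diagram_tfae_of_supersingular
    (hBKO : thm15_analyticRank_eq_one_of_selmerCorank_eq_one)
    (hGZK : rank_eq_analyticRank_of_analyticRank_le_one)
    (W : WeierstrassCurve ℚ) [W.IsElliptic] [W.IsGloballyMinimal] (hCM : W.HasCM)
    (p : ℕ) [Fact p.Prime] (hp : 5 ≤ p) (hgood : W.HasGoodReductionAtPrime p)
    (hss : (p : ℤ) ∣ W.frobeniusTrace p) :
    List.TFAE [W.mordellWeilRank = 1 ∧ Finite (AddCommGroup.primaryComponent W.sha p),
      W.analyticRank = 1, W.mordellWeilRank = 1 ∧ Finite W.sha] := by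
  tfae_have 1 → 2 := fun h ↦
    analyticRank_eq_one_of_mordellWeilRank_eq_one_of_finite_sha_primary hBKO W hCM p hp hgood hss
      h.1 h.2
  tfae_have 2 → 3 := fun h ↦ by
    obtain ⟨hrank, hsha⟩ := hGZK W h.le
    exact ⟨by rw [hrank, h], hsha⟩
  tfae_have 3 → 1 := fun h ↦ by
    haveI := h.2
    exact ⟨h.1, inferInstance⟩
  tfae_finish

end Literature.NumberTheory.EllipticCurves.BurungaleKobayashiOta2024

end
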